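import Summits.BirchSwinnertonDyer.BirchSwinnertonDyer.Theses.GenusKolyvaginAtTwo
import Summits.BirchSwinnertonDyer.BirchSwinnertonDyer.Theorems.GenusKolyvaginAtTwoGenusDeepSupplyAtTwoNegDiscSelmerNecessity
import HarnessLib

/-!
# SKELETON LINE `narrow_plus_wide_cells` for item 23467 `GenusDeepSupplyAtTwoNegDisc` (route GenusKolyvaginAtTwo, ASIDE r2 — the WIDE supply on Δ < 0)

line-writer skeleton (linewriter-bsd-genuskolyattwo-1 g0); NOT leaf progress. The wide supply 23467 asks, for EVERY habitat curve (non-CM E/ℚ,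
r_an = 0, ρ_{E,2^∞} onto, odd Tamagawa product, Δ < 0, an odd-Manin optimal parametrisation), a Heegner frame with a DEEP witness P(n) ∉ 2E(K[n])
and a Sel₂-minimal twin. Its NARROW twin 23491 `GenusDeepSupplyAtTwoNegDiscNarrow` is 23467 VERBATIM with the extra hypothesis `#Sel₂(E/ℚ) = 1 ∨ 4`
(the K₁/K₄ cells; glue 31527 reduces it to K1Neg ∧ K4Neg), and the landed KERNEL NECESSITY
`GenusExact.PlusDescent.natCard_selmerGroup_two_dvd_four_of_genusDeepSupplyAtTwoNegDisc` (p752199; Mazur–Rubin Cor. 3.4 (i) at the transposition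
prime of d_K) shows 23467 FORCES `#Sel₂(E/ℚ) ∣ 4` on the whole habitat. So 23467 ⟺ 23491 ∧ (WIDE CELLS EMPTY), and this skeleton is exactly that:
* stub NARROW = item 23491 BY NAME;
* stub DVD4 [research — HEURISTICALLY FALSE as a theorem about all curves (BKLPR/Delaunay: dim Ш(E)[2] = 4 has positive density among rank-0
  curves and the habitat conditions are local/independent of it), TABULATED-EMPTY: pen bsd-idea-1 g22 kit j336982 — 858/858 Cremona habitat curves
  with Δ < 0 ∧ 16 ∣ Ш_an (N < 5·10⁵) have Sel₂-rank 2, control j337000: no S₃-image rank-0 curve with N < 5·10⁵ has dim Ш[2] ≥ 4]: `#Sel₂(E/ℚ) ∣ 4` on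
  the habitat — by the necessity theorem this stub is IMPLIED BY 23467 itself, so it is the exact excess of WIDE over NARROW, not a planner's choice;
* stub NE2 [print]: `#Sel₂(E/ℚ) ≠ 2` on the habitat (r_an = 0 ⇒ E(ℚ) finite and Ш(E)[2^∞] finite — Kato / GZK; ρ̄_{E,2} onto ⇒ E(ℚ)[2] = 0 ⇒
  Sel₂(E) ≅ Ш(E)[2], of square order by Cassels–Tate).
Composition PROVED (a ∣ 4 ∧ a ≠ 2 ⇒ a = 1 ∨ a = 4, then NARROW). Census reading: 23467 is an ASIDE precisely because stub DVD4 is expected to be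
false; its refutation target is ONE habitat curve with dim_𝔽₂ Ш(E)[2] = 4 (none below conductor 5·10⁵). Sorries ONLY inside `stub_*`; nothing
asserted; BSD is proved for no curve.
-/

set_option autoImplicit false
set_option linter.dupNamespace false

namespace Summit.BirchSwinnertonDyer.BirchSwinnertonDyer.Cruxes.GenusDeepSupplyAtTwoNegDisc.NarrowPlusWideCells

open Literature.NumberTheory.EllipticCurves Literature.NumberTheory.EllipticCurves.ModularForms
open Summit.BirchSwinnertonDyer.BirchSwinnertonDyer.Theses.GenusKolyvaginAtTwo
  (GenusDeepSupplyAtTwoNegDisc GenusDeepSupplyAtTwoNegDiscNarrow)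

/-- [research · ITEM BY NAME = `GenusDeepSupplyAtTwoNegDiscNarrow` 23491] the supply on the K₁/K₄ cells (`#Sel₂(E) = 1 ∨ 4`); reduced by the
route's glue 31527 to K1Neg (31525) ∧ K4Neg (31526) modulo print (`GenusSupplyNarrow.PrimeFrame.genusDeepSupplyAtTwoNegDiscNarrow_of_items_of_selmerSplit_mixed`).
[cite: Kolyvagin1991MathAnn, Thm. 1] [cite: GrossLMS1991, §3] -/
theorem stub_narrow : GenusDeepSupplyAtTwoNegDiscNarrow := by
  sorry

/-- [research · HEURISTICALLY FALSE, tabulated-empty N < 5·10⁵ (kit j336982 / j337000)] WIDE CELLS EMPTY: on the habitat (non-CM, r_an = 0,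
ρ_{E,2^∞} onto, odd Tamagawa product, Δ < 0, odd-Manin optimal parametrisation) `#Sel₂(E/ℚ) ∣ 4`. NECESSARY for 23467 by the landed
`natCard_selmerGroup_two_dvd_four_of_genusDeepSupplyAtTwoNegDisc` (Mazur–Rubin Cor. 3.4 (i)). Refutation target: a habitat curve with
dim Ш(E)[2] = 4. [cite: MazurRubin2010, Cor. 3.4 (i)] [cite: BhargavaKaneLenstraPoonenRains2015, §5 (heuristic)] -/
theorem stub_selmerCard_dvd_four_on_habitat :
    ∀ (W : WeierstrassCurve ℚ) [W.IsElliptic] [W.IsGloballyMinimal] [NeZero (W.conductorNorm ℤ)], ¬ W.HasCM → W.analyticRank = 0 →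
      (∀ n : ℕ, 0 < n → W.HasSurjectiveModNGaloisRep ((2 : ℤ) ^ n)) → Odd W.tamagawaProduct → W.Δ < 0 →
      (∃ Dt : ModularParametrizationData W (W.conductorNorm ℤ), (∀ z ∈ Dt.L.lattice, ∃ w ∈ periodLattice Dt.f, z = (Dt.c : ℂ) * w) ∧ Odd Dt.c) →
      Nat.card (W.selmerGroup 2) ∣ 4 := by
  sorry

/-- [print] NO CELL OF ORDER TWO: on the habitat `#Sel₂(E/ℚ) ≠ 2` — `L(E,1) ≠ 0` (r_an = 0, entire continuation) ⇒ E(ℚ) and Ш(E)[2^∞] finite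
(Kato, Astérisque 295 Cor. 14.3; or Gross–Zagier–Kolyvagin), ρ̄_{E,2} onto ⇒ E(ℚ)[2] = 0 ⇒ Sel₂(E/ℚ) ≅ Ш(E/ℚ)[2], whose order is a square
(Cassels 1962 IV, Thm. 1.2: the Cassels–Tate pairing on the finite group Ш[2^∞] is alternating and non-degenerate).
[cite: Kato2004Asterisque, Cor. 14.3 (p. 235)] [cite: Cassels1962ArithmeticIV, Thm. 1.2] -/
theorem stub_selmerCard_ne_two_on_habitat :
    ∀ (W : WeierstrassCurve ℚ) [W.IsElliptic] [W.IsGloballyMinimal] [NeZero (W.conductorNorm ℤ)], ¬ W.HasCM → W.analyticRank = 0 →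
      (∀ n : ℕ, 0 < n → W.HasSurjectiveModNGaloisRep ((2 : ℤ) ^ n)) → Odd W.tamagawaProduct → W.Δ < 0 →
      (∃ Dt : ModularParametrizationData W (W.conductorNorm ℤ), (∀ z ∈ Dt.L.lattice, ∃ w ∈ periodLattice Dt.f, z = (Dt.c : ℂ) * w) ∧ Odd Dt.c) →
      Nat.card (W.selmerGroup 2) ≠ 2 := by
  sorry

/-- A divisor of `4` other than `2` is `1` or `4`. [folklore] -/
theorem eq_one_or_eq_four_of_dvd_four_of_ne_two {a : ℕ} (h4 : a ∣ 4) (h2 : a ≠ 2) : a = 1 ∨ a = 4 := by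
  have h4' : a ∣ 2 ^ 2 := by simpa using h4
  obtain ⟨k, hk, rfl⟩ := (Nat.dvd_prime_pow Nat.prime_two).1 h4'
  interval_cases k <;> simp_all

/-- **Composition (kernel-checked): `GenusDeepSupplyAtTwoNegDisc`** (item 23467) BY NAME = NARROW (23491) on the cells `#Sel₂ = 1 ∨ 4`, which
exhaust the habitat by DVD4 (research, heuristically false) and NE2 (print). [cite: MazurRubin2010, Cor. 3.4 (i)] [cite: Cassels1962ArithmeticIV, Thm. 1.2] -/
theorem GenusDeepSupplyAtTwoNegDisc_of : GenusDeepSupplyAtTwoNegDisc := by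
  intro W _ _ _ hcm hr0 hρ hT hΔ hopt
  exact stub_narrow W hcm hr0 hρ hT hΔ hopt
    (eq_one_or_eq_four_of_dvd_four_of_ne_two (stub_selmerCard_dvd_four_on_habitat W hcm hr0 hρ hT hΔ hopt)
      (stub_selmerCard_ne_two_on_habitat W hcm hr0 hρ hT hΔ hopt))

end Summit.BirchSwinnertonDyer.BirchSwinnertonDyer.Cruxes.GenusDeepSupplyAtTwoNegDisc.NarrowPlusWideCells
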